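import Summits.Langlands.Langlands.Theses.CofinitePrimeSplit
import Literature.NumberTheory.Automorphic.EssConjSelfDual
/-!
BC3 BIRTH SKELETON — crux CPI `CofinitePrimeIrreducible` of the child route `CofinitePrimeSplit` (lens-5 g16; refines NRM stmt-Langlands-31315 of
route-Langlands-RootDecomp1).  POST-BIRTH form: imports the born route file and concludes the item BY NAME (use this one for `ledger crux write … Lines/birth.lean` + `ledger skeleton check`).
Three registered stubs = the cell cut by the PRINT SECTOR of Hui 2023 Thm 1.4 (base field × polarization, n ≤ 6, regular): `stub_cpi_tr` (K totally
real, π regular and essentially self-dual: IN PRINT), `stub_cpi_cm` (K CM, π regular and essentially conjugate-self-dual: IN PRINT — the BC5 PLAN-ONLY RUNG: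
for CM K and n ∈ {4,5,6} CPI is a theorem while NRM (all λ) is open), `stub_cpi_rest` (the complement: dark), and the kernel-checked composition
`CofinitePrimeIrreducible_of` (one case split on the sector, then TR ∣ CM).  None is bookkeeping, none ⟺ the cell or NRM (kit probes).  sorries ONLY inside `stub_*`.
-/
set_option linter.dupNamespace false
open scoped BigOperators Topology Manifold Classical MeasureTheory ProbabilityTheory Matrix InnerProductSpace ComplexConjugate ContinuousMap
open Filter Set Function TopologicalSpace MeasureTheory
namespace Summit.Langlands.Langlands.Cruxes.CofinitePrimeIrreducible.Birth

/-- BC5 PLAN-ONLY RUNG = first stub: CPI on Hui's CM sector — K a CM field, n ≤ 6, π (cuspidal, L-algebraic, no regular-monodromy place) REGULAR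
(`∃ T, HasInfinityType T ∧ T.IsRegular`) and ESSENTIALLY CONJUGATE-SELF-DUAL (`∃ χ, π.IsEssConjSelfDual χ`, BLGGT §2.1 polarized).  IN PRINT: Hui 2023
(J. LMS 108) Thm 1.4 [corpus:paper:arxiv-2208.04002 p4] — ρ_{π,λ} ⊗ ℚ̄_ℓ irreducible for almost all λ — modulo (a) the twist π ↦ π ⊗ |det|^{(n−1)/2}
(L-algebraic regular ↔ regular algebraic) and (b) «every SEMISIMPLE ρ Satake-compatible with (π, ι) a.e. is ≅ ρ_{π,ι}^ss» (Chebotarev + Brauer–Nesbitt,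
tree shape `SoloBlind.isIrreducible_of_eventually`); finitely many exceptional λ lie over finitely many ℓ, whence `∃ S : Finset ℕ`.  OUTSIDE NRM's known
regime: for CM K and n = 4, 5, 6 irreducibility at ALL λ is open (all-λ results: n ≤ 3, GL₄ over totally real fields only).  Exercises the route's lever
(cofinite-in-ℓ) and not the residual IPT.  Technique named: potential automorphy of low-dimensional constituents (BLGGT) + Hui's big-monodromy /
algebraic-envelope results + Rankin–Selberg (Hui 2023 §§1c, 3–4).  Size L (formalising a published theorem schema on top of E-rational systems). -/
theorem stub_cpi_cm : ∀ (K : Type) [Field K] [NumberField K] [NumberField.IsCMField K] (n : ℕ) (hcpt : Literature.NumberTheory.Automorphic.isCompact_glFiniteIntegralLevel n K), 0 < n → ∀ (π : Literature.NumberTheory.Automorphic.CuspidalAutomorphicRepData n K hcpt), π.1.IsLAlgebraic → n ≤ 6 → (∃ T : Literature.NumberTheory.Automorphic.InfinityType K n, π.1.HasInfinityType T ∧ T.IsRegular) → (∃ χ : Literature.NumberTheory.GaloisRepresentations.HeckeCharacter K, π.1.IsEssConjSelfDual χ) → ¬ (∃ (v : IsDedekindDomain.HeightOneSpectrum (NumberField.RingOfIntegers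 K)) (πv : Literature.NumberTheory.Automorphic.SmoothIrrep (Matrix.GeneralLinearGroup (Fin n) (v.adicCompletion K))), π.1.HasLocalComponentAt v πv.ρ ∧ (∀ [MeasurableSpace (Matrix.GeneralLinearGroup (Fin n) (v.adicCompletion K) ⧸ Subgroup.center (Matrix.GeneralLinearGroup (Fin n) (v.adicCompletion K)))] [BorelSpace (Matrix.GeneralLinearGroup (Fin n) (v.adicCompletion K) ⧸ Subgroup.center (Matrix.GeneralLinearGroup (Fin n) (v.adicCompletion K)))] (μ : MeasureTheory.Measure (Matrix.GeneralLinearGroup (Fin n) (v.adicCompletion K) ⧸ Subgroup.center (Matrix.GeneralLinearGroup (Fin n) (v.adicCompletion K)))) [μ.IsHaarMeasure], πv.ρ.IsEssentiallyDiscreteSeries μ) ∧ ∃ χ : Matrix.GeneralLinearGroup (Fin n) (v.adicCompletion K) →* ℂˣ, IsOpen (χ.ker : Set (Matrix.GeneralLinearGroup (Fin n) (v.adicCompletion K))) ∧ ∃ w : πv.V, w ≠ 0 ∧ ∀ g ∈ Literature.NumberTheory.Automorphic.iwahoriGL n (v.adicCompletion K), (πv.ρ.twist χ) g w = w) → (∀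 m : ℕ, m < n → ∀ (K : Type) [Field K] [NumberField K] (hcpt : Literature.NumberTheory.Automorphic.isCompact_glFiniteIntegralLevel m K), 0 < m → ∀ (π : Literature.NumberTheory.Automorphic.CuspidalAutomorphicRepData m K hcpt), π.1.IsLAlgebraic → ∀ (ℓ : ℕ) [Fact ℓ.Prime] (ι : PadicAlgCl ℓ ≃+* ℂ) (ρ : Literature.NumberTheory.GaloisRepresentations.FramedGaloisRep K (PadicAlgCl ℓ) m), ρ.toGaloisRep.IsSemisimple → (∀ᶠ v : IsDedekindDomain.HeightOneSpectrum (NumberField.RingOfIntegers K) in cofinite, SatakeFrobCompatibleAt ι π.1 ρ v) → ρ.toGaloisRep.IsIrreducible) → ∃ S : Finset ℕ, ∀ (ℓ : ℕ) [Fact ℓ.Prime], ℓ ∉ S → ∀ (ι : PadicAlgCl ℓ ≃+* ℂ) (ρ : Literature.NumberTheory.GaloisRepresentations.FramedGaloisRep K (PadicAlgCl ℓ) n), ρ.toGaloisRep.IsSemisimple → (∀ᶠ v : IsDedekindDomain.HeightOneSpectrum (NumberField.RingOfIntegers K) in cofinite, SatakeFrobCompatibleAt ι π.1 ρ v) → ρ.toGaloisRep.IsIrreducible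 := by
  sorry

/-- TOTALLY REAL SECTOR: K totally real, n ≤ 6, π regular and ESSENTIALLY SELF-DUAL (`∃ χ, π.IsGalConjEssSelfDual 1 χ`).  IN PRINT: Hui 2023 Thm 1.4
(F totally real, n ≤ 6; n ≤ 5 density one already Calegari–Gee 2013) [corpus:paper:arxiv-2208.04002 p4], same provisos (a)/(b).  Size L. -/
theorem stub_cpi_tr : ∀ (K : Type) [Field K] [NumberField K] [NumberField.IsTotallyReal K] (n : ℕ) (hcpt : Literature.NumberTheory.Automorphic.isCompact_glFiniteIntegralLevel n K), 0 < n → ∀ (π : Literature.NumberTheory.Automorphic.CuspidalAutomorphicRepData n K hcpt), π.1.IsLAlgebraic → n ≤ 6 → (∃ T : Literature.NumberTheory.Automorphic.InfinityType K n, π.1.HasInfinityType T ∧ T.IsRegular) → (∃ χ : Literature.NumberTheory.GaloisRepresentations.HeckeCharacter K, π.1.IsGalConjEssSelfDual (AlgEquiv.refl : K ≃ₐ[ℚ] K) χ) → ¬ (∃ (v : IsDedekindDomain.HeightOneSpectrum (NumberField.RingOfIntegers K)) (πv : Literature.NumberTheory.Automorphic.SmoothIrrep (Matrix.GeneralLinearGroup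 (Fin n) (v.adicCompletion K))), π.1.HasLocalComponentAt v πv.ρ ∧ (∀ [MeasurableSpace (Matrix.GeneralLinearGroup (Fin n) (v.adicCompletion K) ⧸ Subgroup.center (Matrix.GeneralLinearGroup (Fin n) (v.adicCompletion K)))] [BorelSpace (Matrix.GeneralLinearGroup (Fin n) (v.adicCompletion K) ⧸ Subgroup.center (Matrix.GeneralLinearGroup (Fin n) (v.adicCompletion K)))] (μ : MeasureTheory.Measure (Matrix.GeneralLinearGroup (Fin n) (v.adicCompletion K) ⧸ Subgroup.center (Matrix.GeneralLinearGroup (Fin n) (v.adicCompletion K)))) [μ.IsHaarMeasure], πv.ρ.IsEssentiallyDiscreteSeries μ) ∧ ∃ χ : Matrix.GeneralLinearGroup (Fin n) (v.adicCompletion K) →* ℂˣ, IsOpen (χ.ker : Set (Matrix.GeneralLinearGroup (Fin n) (v.adicCompletion K))) ∧ ∃ w : πv.V, w ≠ 0 ∧ ∀ g ∈ Literature.NumberTheory.Automorphic.iwahoriGL n (v.adicCompletion K), (πv.ρ.twist χ) g w = w) → (∀ m : ℕ, m < n → ∀ (K : Type) [Field K] [NumberField K] (hcpt : Literature.NumberTheory.Automorphic.isCompact_glFiniteIntegralLevel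 m K), 0 < m → ∀ (π : Literature.NumberTheory.Automorphic.CuspidalAutomorphicRepData m K hcpt), π.1.IsLAlgebraic → ∀ (ℓ : ℕ) [Fact ℓ.Prime] (ι : PadicAlgCl ℓ ≃+* ℂ) (ρ : Literature.NumberTheory.GaloisRepresentations.FramedGaloisRep K (PadicAlgCl ℓ) m), ρ.toGaloisRep.IsSemisimple → (∀ᶠ v : IsDedekindDomain.HeightOneSpectrum (NumberField.RingOfIntegers K) in cofinite, SatakeFrobCompatibleAt ι π.1 ρ v) → ρ.toGaloisRep.IsIrreducible) → ∃ S : Finset ℕ, ∀ (ℓ : ℕ) [Fact ℓ.Prime], ℓ ∉ S → ∀ (ι : PadicAlgCl ℓ ≃+* ℂ) (ρ : Literature.NumberTheory.GaloisRepresentations.FramedGaloisRep K (PadicAlgCl ℓ) n), ρ.toGaloisRep.IsSemisimple → (∀ᶠ v : IsDedekindDomain.HeightOneSpectrum (NumberField.RingOfIntegers K) in cofinite, SatakeFrobCompatibleAt ι π.1 ρ v) → ρ.toGaloisRep.IsIrreducible := by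
  sorry

/-- THE REST (dark, booked — not cut): CPI off Hui's sector — n ≥ 7 (print only n = 7, 8 over ℚ, Dai 2025 [corpus:paper:arxiv-2510.12496 p2]),
irregular π (no compatible system known: E dark; NonRegularWeightBarrier), non-polarizable π (CM n ≤ 3 / GL₄-TR islands only: Böckle–Hui 2025,
Shavali 2026; TwistedEndoscopySelfDual), K neither totally real nor CM (ShimuraVarietyRealizationBarrier).  Partial in all ranks: density-one /
positive-density irreducibility (BLGGT 2014, Patrikis–Taylor 2015, Feng–Whitmore 2025) — strictly short of cofinite.  Size XL / open. -/
theorem stub_cpi_rest : ∀ (K : Type) [Field K] [NumberField K] (n : ℕ) (hcpt : Literature.NumberTheory.Automorphic.isCompact_glFiniteIntegralLevel n K), 0 < n → ∀ (π : Literature.NumberTheory.Automorphic.CuspidalAutomorphicRepData n K hcpt), π.1.IsLAlgebraic → ¬ (n ≤ 6 ∧ (∃ T : Literature.NumberTheory.Automorphic.InfinityType K n, π.1.HasInfinityType T ∧ T.IsRegular) ∧ ((NumberField.IsTotallyReal K ∧ ∃ χ : Literature.NumberTheory.GaloisRepresentations.HeckeCharacter K, π.1.IsGalConjEssSelfDual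 (AlgEquiv.refl : K ≃ₐ[ℚ] K) χ) ∨ (∃ _ : NumberField.IsCMField K, ∃ χ : Literature.NumberTheory.GaloisRepresentations.HeckeCharacter K, π.1.IsEssConjSelfDual χ))) → ¬ (∃ (v : IsDedekindDomain.HeightOneSpectrum (NumberField.RingOfIntegers K)) (πv : Literature.NumberTheory.Automorphic.SmoothIrrep (Matrix.GeneralLinearGroup (Fin n) (v.adicCompletion K))), π.1.HasLocalComponentAt v πv.ρ ∧ (∀ [MeasurableSpace (Matrix.GeneralLinearGroup (Fin n) (v.adicCompletion K) ⧸ Subgroup.center (Matrix.GeneralLinearGroup (Fin n) (v.adicCompletion K)))] [BorelSpace (Matrix.GeneralLinearGroup (Fin n) (v.adicCompletion K) ⧸ Subgroup.center (Matrix.GeneralLinearGroup (Fin n) (v.adicCompletion K)))] (μ : MeasureTheory.Measure (Matrix.GeneralLinearGroup (Fin n) (v.adicCompletion K) ⧸ Subgroup.center (Matrix.GeneralLinearGroup (Fin n) (v.adicCompletion K)))) [μ.IsHaarMeasure], πv.ρ.IsEssentiallyDiscreteSeries μ) ∧ ∃ χ : Matrix.GeneralLinearGroup (Fin n) (v.adicCompletion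 K) →* ℂˣ, IsOpen (χ.ker : Set (Matrix.GeneralLinearGroup (Fin n) (v.adicCompletion K))) ∧ ∃ w : πv.V, w ≠ 0 ∧ ∀ g ∈ Literature.NumberTheory.Automorphic.iwahoriGL n (v.adicCompletion K), (πv.ρ.twist χ) g w = w) → (∀ m : ℕ, m < n → ∀ (K : Type) [Field K] [NumberField K] (hcpt : Literature.NumberTheory.Automorphic.isCompact_glFiniteIntegralLevel m K), 0 < m → ∀ (π : Literature.NumberTheory.Automorphic.CuspidalAutomorphicRepData m K hcpt), π.1.IsLAlgebraic → ∀ (ℓ : ℕ) [Fact ℓ.Prime] (ι : PadicAlgCl ℓ ≃+* ℂ) (ρ : Literature.NumberTheory.GaloisRepresentations.FramedGaloisRep K (PadicAlgCl ℓ) m), ρ.toGaloisRep.IsSemisimple → (∀ᶠ v : IsDedekindDomain.HeightOneSpectrum (NumberField.RingOfIntegers K) in cofinite, SatakeFrobCompatibleAt ι π.1 ρ v) → ρ.toGaloisRep.IsIrreducible) → ∃ S : Finset ℕ, ∀ (ℓ : ℕ) [Fact ℓ.Prime], ℓ ∉ S → ∀ (ι : PadicAlgCl ℓ ≃+* ℂ)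 (ρ : Literature.NumberTheory.GaloisRepresentations.FramedGaloisRep K (PadicAlgCl ℓ) n), ρ.toGaloisRep.IsSemisimple → (∀ᶠ v : IsDedekindDomain.HeightOneSpectrum (NumberField.RingOfIntegers K) in cofinite, SatakeFrobCompatibleAt ι π.1 ρ v) → ρ.toGaloisRep.IsIrreducible := by
  sorry

/-- KERNEL-CHECKED COMPOSITION (real proof, no sorry): the three sector stubs rebuild CPI BY NAME (born route decl) — one
classical case split on Hui's sector predicate, then totally real ∣ CM. -/
theorem CofinitePrimeIrreducible_of :
    (∀ (K : Type) [Field K] [NumberField K] [NumberField.IsCMField K] (n : ℕ) (hcpt : Literature.NumberTheory.Automorphic.isCompact_glFiniteIntegralLevel n K), 0 < n → ∀ (π : Literature.NumberTheory.Automorphic.CuspidalAutomorphicRepData n K hcpt), π.1.IsLAlgebraic → n ≤ 6 → (∃ T : Literature.NumberTheory.Automorphic.InfinityType K n, π.1.HasInfinityType T ∧ T.IsRegular) → (∃ χ : Literature.NumberTheory.GaloisRepresentations.HeckeCharacter K, π.1.IsEssConjSelfDual χ) → ¬ (∃ (v : IsDedekindDomain.HeightOneSpectrum (NumberField.RingOfIntegers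 K)) (πv : Literature.NumberTheory.Automorphic.SmoothIrrep (Matrix.GeneralLinearGroup (Fin n) (v.adicCompletion K))), π.1.HasLocalComponentAt v πv.ρ ∧ (∀ [MeasurableSpace (Matrix.GeneralLinearGroup (Fin n) (v.adicCompletion K) ⧸ Subgroup.center (Matrix.GeneralLinearGroup (Fin n) (v.adicCompletion K)))] [BorelSpace (Matrix.GeneralLinearGroup (Fin n) (v.adicCompletion K) ⧸ Subgroup.center (Matrix.GeneralLinearGroup (Fin n) (v.adicCompletion K)))] (μ : MeasureTheory.Measure (Matrix.GeneralLinearGroup (Fin n) (v.adicCompletion K) ⧸ Subgroup.center (Matrix.GeneralLinearGroup (Fin n) (v.adicCompletion K)))) [μ.IsHaarMeasure], πv.ρ.IsEssentiallyDiscreteSeries μ) ∧ ∃ χ : Matrix.GeneralLinearGroup (Fin n) (v.adicCompletion K) →* ℂˣ, IsOpen (χ.ker : Set (Matrix.GeneralLinearGroup (Fin n) (v.adicCompletion K))) ∧ ∃ w : πv.V, w ≠ 0 ∧ ∀ g ∈ Literature.NumberTheory.Automorphic.iwahoriGL n (v.adicCompletion K), (πv.ρ.twist χ) g w = w) → (∀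 m : ℕ, m < n → ∀ (K : Type) [Field K] [NumberField K] (hcpt : Literature.NumberTheory.Automorphic.isCompact_glFiniteIntegralLevel m K), 0 < m → ∀ (π : Literature.NumberTheory.Automorphic.CuspidalAutomorphicRepData m K hcpt), π.1.IsLAlgebraic → ∀ (ℓ : ℕ) [Fact ℓ.Prime] (ι : PadicAlgCl ℓ ≃+* ℂ) (ρ : Literature.NumberTheory.GaloisRepresentations.FramedGaloisRep K (PadicAlgCl ℓ) m), ρ.toGaloisRep.IsSemisimple → (∀ᶠ v : IsDedekindDomain.HeightOneSpectrum (NumberField.RingOfIntegers K) in cofinite, SatakeFrobCompatibleAt ι π.1 ρ v) → ρ.toGaloisRep.IsIrreducible) → ∃ S : Finset ℕ, ∀ (ℓ : ℕ) [Fact ℓ.Prime], ℓ ∉ S → ∀ (ι : PadicAlgCl ℓ ≃+* ℂ) (ρ : Literature.NumberTheory.GaloisRepresentations.FramedGaloisRep K (PadicAlgCl ℓ) n), ρ.toGaloisRep.IsSemisimple → (∀ᶠ v : IsDedekindDomain.HeightOneSpectrum (NumberField.RingOfIntegers K) in cofinite, SatakeFrobCompatibleAt ι π.1 ρ v) → ρ.toGaloisRep.IsIrreducible)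 →
    (∀ (K : Type) [Field K] [NumberField K] [NumberField.IsTotallyReal K] (n : ℕ) (hcpt : Literature.NumberTheory.Automorphic.isCompact_glFiniteIntegralLevel n K), 0 < n → ∀ (π : Literature.NumberTheory.Automorphic.CuspidalAutomorphicRepData n K hcpt), π.1.IsLAlgebraic → n ≤ 6 → (∃ T : Literature.NumberTheory.Automorphic.InfinityType K n, π.1.HasInfinityType T ∧ T.IsRegular) → (∃ χ : Literature.NumberTheory.GaloisRepresentations.HeckeCharacter K, π.1.IsGalConjEssSelfDual (AlgEquiv.refl : K ≃ₐ[ℚ] K) χ) → ¬ (∃ (v : IsDedekindDomain.HeightOneSpectrum (NumberField.RingOfIntegers K)) (πv : Literature.NumberTheory.Automorphic.SmoothIrrep (Matrix.GeneralLinearGroup (Fin n) (v.adicCompletion K))), π.1.HasLocalComponentAt v πv.ρ ∧ (∀ [MeasurableSpace (Matrix.GeneralLinearGroup (Fin n) (v.adicCompletion K) ⧸ Subgroup.center (Matrix.GeneralLinearGroup (Fin n) (v.adicCompletion K)))] [BorelSpace (Matrix.GeneralLinearGroup (Fin n) (v.adicCompletion K) ⧸ Subgroup.center (Matrix.GeneralLinearGroup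 (Fin n) (v.adicCompletion K)))] (μ : MeasureTheory.Measure (Matrix.GeneralLinearGroup (Fin n) (v.adicCompletion K) ⧸ Subgroup.center (Matrix.GeneralLinearGroup (Fin n) (v.adicCompletion K)))) [μ.IsHaarMeasure], πv.ρ.IsEssentiallyDiscreteSeries μ) ∧ ∃ χ : Matrix.GeneralLinearGroup (Fin n) (v.adicCompletion K) →* ℂˣ, IsOpen (χ.ker : Set (Matrix.GeneralLinearGroup (Fin n) (v.adicCompletion K))) ∧ ∃ w : πv.V, w ≠ 0 ∧ ∀ g ∈ Literature.NumberTheory.Automorphic.iwahoriGL n (v.adicCompletion K), (πv.ρ.twist χ) g w = w) → (∀ m : ℕ, m < n → ∀ (K : Type) [Field K] [NumberField K] (hcpt : Literature.NumberTheory.Automorphic.isCompact_glFiniteIntegralLevel m K), 0 < m → ∀ (π : Literature.NumberTheory.Automorphic.CuspidalAutomorphicRepData m K hcpt), π.1.IsLAlgebraic → ∀ (ℓ : ℕ) [Fact ℓ.Prime] (ι : PadicAlgCl ℓ ≃+* ℂ) (ρ : Literature.NumberTheory.GaloisRepresentations.FramedGaloisRep K (PadicAlgCl ℓ) m), ρ.toGaloisRep.IsSemisimple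 → (∀ᶠ v : IsDedekindDomain.HeightOneSpectrum (NumberField.RingOfIntegers K) in cofinite, SatakeFrobCompatibleAt ι π.1 ρ v) → ρ.toGaloisRep.IsIrreducible) → ∃ S : Finset ℕ, ∀ (ℓ : ℕ) [Fact ℓ.Prime], ℓ ∉ S → ∀ (ι : PadicAlgCl ℓ ≃+* ℂ) (ρ : Literature.NumberTheory.GaloisRepresentations.FramedGaloisRep K (PadicAlgCl ℓ) n), ρ.toGaloisRep.IsSemisimple → (∀ᶠ v : IsDedekindDomain.HeightOneSpectrum (NumberField.RingOfIntegers K) in cofinite, SatakeFrobCompatibleAt ι π.1 ρ v) → ρ.toGaloisRep.IsIrreducible) →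
    (∀ (K : Type) [Field K] [NumberField K] (n : ℕ) (hcpt : Literature.NumberTheory.Automorphic.isCompact_glFiniteIntegralLevel n K), 0 < n → ∀ (π : Literature.NumberTheory.Automorphic.CuspidalAutomorphicRepData n K hcpt), π.1.IsLAlgebraic → ¬ (n ≤ 6 ∧ (∃ T : Literature.NumberTheory.Automorphic.InfinityType K n, π.1.HasInfinityType T ∧ T.IsRegular) ∧ ((NumberField.IsTotallyReal K ∧ ∃ χ : Literature.NumberTheory.GaloisRepresentations.HeckeCharacter K, π.1.IsGalConjEssSelfDual (AlgEquiv.refl : K ≃ₐ[ℚ] K) χ) ∨ (∃ _ : NumberField.IsCMField K, ∃ χ : Literature.NumberTheory.GaloisRepresentations.HeckeCharacter K, π.1.IsEssConjSelfDual χ))) → ¬ (∃ (v : IsDedekindDomain.HeightOneSpectrum (NumberField.RingOfIntegers K)) (πv : Literature.NumberTheory.Automorphic.SmoothIrrep (Matrix.GeneralLinearGroup (Fin n) (v.adicCompletion K))), π.1.HasLocalComponentAt v πv.ρ ∧ (∀ [MeasurableSpace (Matrix.GeneralLinearGroup (Fin n) (v.adicCompletion K) ⧸ Subgroup.center (Matrix.GeneralLinearGroup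 (Fin n) (v.adicCompletion K)))] [BorelSpace (Matrix.GeneralLinearGroup (Fin n) (v.adicCompletion K) ⧸ Subgroup.center (Matrix.GeneralLinearGroup (Fin n) (v.adicCompletion K)))] (μ : MeasureTheory.Measure (Matrix.GeneralLinearGroup (Fin n) (v.adicCompletion K) ⧸ Subgroup.center (Matrix.GeneralLinearGroup (Fin n) (v.adicCompletion K)))) [μ.IsHaarMeasure], πv.ρ.IsEssentiallyDiscreteSeries μ) ∧ ∃ χ : Matrix.GeneralLinearGroup (Fin n) (v.adicCompletion K) →* ℂˣ, IsOpen (χ.ker : Set (Matrix.GeneralLinearGroup (Fin n) (v.adicCompletion K))) ∧ ∃ w : πv.V, w ≠ 0 ∧ ∀ g ∈ Literature.NumberTheory.Automorphic.iwahoriGL n (v.adicCompletion K), (πv.ρ.twist χ) g w = w) → (∀ m : ℕ, m < n → ∀ (K : Type) [Field K] [NumberField K] (hcpt : Literature.NumberTheory.Automorphic.isCompact_glFiniteIntegralLevel m K), 0 < m → ∀ (π : Literature.NumberTheory.Automorphic.CuspidalAutomorphicRepData m K hcpt), π.1.IsLAlgebraic → ∀ (ℓ : ℕ) [Fact ℓ.Prime]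 (ι : PadicAlgCl ℓ ≃+* ℂ) (ρ : Literature.NumberTheory.GaloisRepresentations.FramedGaloisRep K (PadicAlgCl ℓ) m), ρ.toGaloisRep.IsSemisimple → (∀ᶠ v : IsDedekindDomain.HeightOneSpectrum (NumberField.RingOfIntegers K) in cofinite, SatakeFrobCompatibleAt ι π.1 ρ v) → ρ.toGaloisRep.IsIrreducible) → ∃ S : Finset ℕ, ∀ (ℓ : ℕ) [Fact ℓ.Prime], ℓ ∉ S → ∀ (ι : PadicAlgCl ℓ ≃+* ℂ) (ρ : Literature.NumberTheory.GaloisRepresentations.FramedGaloisRep K (PadicAlgCl ℓ) n), ρ.toGaloisRep.IsSemisimple → (∀ᶠ v : IsDedekindDomain.HeightOneSpectrum (NumberField.RingOfIntegers K) in cofinite, SatakeFrobCompatibleAt ι π.1 ρ v) → ρ.toGaloisRep.IsIrreducible) →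
    Summit.Langlands.Langlands.Theses.CofinitePrimeSplit.CofinitePrimeIrreducible := by
  intro hcm htr hrest K _ _ n hcpt hn π hL
  by_cases hsec : (n ≤ 6 ∧ (∃ T : Literature.NumberTheory.Automorphic.InfinityType K n, π.1.HasInfinityType T ∧ T.IsRegular) ∧ ((NumberField.IsTotallyReal K ∧ ∃ χ : Literature.NumberTheory.GaloisRepresentations.HeckeCharacter K, π.1.IsGalConjEssSelfDual (AlgEquiv.refl : K ≃ₐ[ℚ] K) χ) ∨ (∃ _ : NumberField.IsCMField K, ∃ χ : Literature.NumberTheory.GaloisRepresentations.HeckeCharacter K, π.1.IsEssConjSelfDual χ)))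
  · obtain ⟨h6, hreg, hpol⟩ := hsec
    rcases hpol with ⟨hTR, hχ⟩ | ⟨hCM, hχ⟩
    · haveI := hTR
      exact htr K n hcpt hn π hL h6 hreg hχ
    · haveI := hCM
      exact hcm K n hcpt hn π hL h6 hreg hχ
  · exact hrest K n hcpt hn π hL hsec

/-- The line closes the crux: composition applied to the stubs. -/
theorem CofinitePrimeIrreducible_holds : Summit.Langlands.Langlands.Theses.CofinitePrimeSplit.CofinitePrimeIrreducible :=
  CofinitePrimeIrreducible_of stub_cpi_cm stub_cpi_tr stub_cpi_rest

end Summit.Langlands.Langlands.Cruxes.CofinitePrimeIrreducible.Birth
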